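import Summits.QuantumFields.YangMills.Theorems.BalabanUVNodesN14ConvexFibreBox
import Summits.QuantumFields.YangMills.Theorems.BalabanUVNodesN14ConvexFibreTilt
import Summits.QuantumFields.BalabanUV.T4Continuum.Spine.NE7b.StrongConvexSubgradientField

/-!
# BalabanUVNodes ∕ node N14 = NE1′ — THE BOUNDED-PERTURBATION LEMMA (Holley–Stroock) FOR THE EXPONENTIAL ENTROPY SCHEMA: tilting a
# fibre law by ANY bounded source keeps the schema with constant `C·e^{2·osc}` — the tilt stability of the engine WITHOUT a Hessian letter

Cell `pub-ymgap`, HUMAN RULING D-0062 (Track A at full width), seat `pub-ymgap-dag-n14-c` (R134 ACCELERATION, strategy s1), generation 4;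
route `Summits/QuantumFields/YangMills/Theses/BalabanUVNodes.lean` (cluster K3′ `SpineGivenEndpointR12`, `--supports … --as helper`); venue
ruling R424 (`YangMills/Theorems`, namespace `YMDAG.N14.ConvexFibrePerturb`).  Sixth file of the convex-fibre engine (A `…Engine`, B `…Window`,
C `…Step`, D `…Box`, E `…Tilt`).  ADDITIVE — imports D (hence A, C and node00-def-RR-2's `UniformlyConvexLogSobolevDomain` with the schema
`HasEntropyExpC1c`), E (`compProd_tilted`) and NE7b's `Spine/NE7b/StrongConvexSubgradientField` (`exists_firstOrderOn_field_of_strongConvexOn`, CITED);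
THEOREMS ONLY (0 `def`), modifies nothing.

WHY.  File B's tilt stability (`firstOrder_sub_mul`) needs the two-sided first-order letter `M` on the source observable `G` (a Hessian bound)
and gives the modulus `λ − l₀M`.  Holley–Stroock's bounded-perturbation lemma is the Hessian-free alternative: if `ν` satisfies the exponential
schema with constant `C` and `a ≤ U ≤ b`, then `ν.tilted U` satisfies it with `C·e^{2(b − a)}` — so the SOURCE TILT `U = s·G` of a bounded
observable costs the factor `e^{4 l₀ B}` and NO regularity of `G` beyond what Herbst needs.

WHAT THIS IS.
* §1 [folklore; cite: Holley–Stroock, J. Stat. Phys. 46 (1987) 1159 — the two-line perturbation argument, here for `Ent(e^φ)`]: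
  `mul_log_sub_nonneg` (`t·log(t∕r) − t + r ≥ 0`), `entropy_exp_le_variational` (`Ent_μ(e^φ) ≤ ∫ (φe^φ − e^φ log r − e^φ + r) dμ` for every
  `r > 0`, with equality at `r = ∫e^φ dμ`), `density_bounds_tilted` (the density of `ν.tilted U` w.r.t. `ν` lies in `[e^{a−b}, e^{b−a}]`),
  **`hasEntropyExpC1c_tilted_of_bounded`** (`HasEntropyExpC1c ν C`, `a ≤ U ≤ b` measurable ⇒ `HasEntropyExpC1c (ν.tilted U) (C·e^{2(b−a)})`).
* §2 THE HESSIAN-FREE TILT OF THE ENGINE [folklore ∘ files A∕D]: **`hasSubgaussianMGF_tilted_of_hasEntropyExpC1c`** — schema `C` for `ν`, ANY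
  bounded measurable source `U` with `a ≤ U ≤ b`, bounded `C¹` observable `F` with `‖DF‖ ≤ L` ⇒ `HasSubgaussianMGF (F − ∫F dν_U) ⟨C·e^{2(b−a)}·L²⟩ ν_U`,
  `ν_U = ν.tilted U`; `hasSubgaussianMGF_sourceTilt_of_uniformlyConvex` (the uniformly log-concave fibre tilted by `s·G`, `|s| ≤ l₀`, `|G| ≤ B₀`:
  parameter `e^{4 l₀ B₀}·L²∕λ`, NO letter on `G` beyond boundedness and measurability).
* §3 THE HESSIAN-FREE TILTED STEP [folklore ∘ files C∕D∕E]: **`hasSubgaussianMGF_tilted_compProd_of_schema`** — fibres with RR-2's schema UNIFORMLY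
  in the background (box fibres included), tilted by a bounded source `s·G`: under `(ν ⊗ₘ κ).tilted (s·G)` the step adds `C·e^{4l₀B₀}·L_F²` — the
  realistic small-field step, no whole-space convexity and no Hessian letter.
* §4 THE BOX ENGINE IN MATHLIB'S `StrongConvexOn` CURRENCY [folklore ∘ file D ∘ NE7b's subgradient field]:
  `hasSubgaussianMGF_box_of_strongConvexOn`, `bornCumulant_box_le_of_strongConvexOn` — `StrongConvexOn Ω c V` + continuity (no differentiability)
  is enough; the NE7b torus actions are typed in exactly this currency (`SupTorusActionConvexEuclid`).

WHAT THIS IS NOT.  Everything here is PROVED (0 `sorry`, 0 named facts).  The factor `e^{2·osc}` is the price of generality (file B's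
`λ − l₀M` is sharper when `G` has a Hessian letter).  Nothing of Bałaban's instantiated; N14 NOT discharged; count-neutral.  One finite
four-torus programme at fixed ε; NOT ℝ⁴, NOT OS, NOT a mass gap, NOT Clay.
-/

noncomputable section

namespace YMDAG.N14.ConvexFibrePerturb

open MeasureTheory ProbabilityTheory Set Filter Topology
open scoped RealInnerProductSpace ENNReal NNReal
open Literature.Analysis.FunctionSpaces (HasEntropyExpC1c isProbabilityMeasure_tilted_neg integrable_of_norm_le_const)
open YMDAG.N14.ConvexFibreEngine (entropyC1c_of_uniformlyConvex)
open YMDAG.N14.ConvexFibreBox (hasSubgaussianMGF_of_hasEntropyExpC1c)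

variable {n : ℕ}

/-! ## §1 Holley–Stroock for the exponential entropy schema -/
section HolleyStroock

/-- `t·log(t∕r) − t + r ≥ 0` for `t, r > 0` (i.e. `x log x − x + 1 ≥ 0`, from `log y ≤ y − 1` at `y = r∕t`). [folklore] -/
theorem mul_log_sub_nonneg {t r : ℝ} (ht : 0 < t) (hr : 0 < r) : 0 ≤ t * Real.log (t / r) - t + r := by
  have h := Real.log_le_sub_one_of_pos (div_pos hr ht)
  have h2 : t * Real.log (r / t) ≤ t * (r / t - 1) := mul_le_mul_of_nonneg_left h ht.le
  have e1 : t * (r / t - 1) = r - t := by field_simp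
  have e2 : Real.log (t / r) = -Real.log (r / t) := by rw [← Real.log_inv, inv_div]
  rw [e2]
  linarith

variable {α : Type*} [MeasurableSpace α] {μ : Measure α} [IsProbabilityMeasure μ]

/-- **THE VARIATIONAL BOUND FOR THE ENTROPY OF `e^φ`** [folklore]: for `φ` bounded measurable and every `r > 0`,
`Ent_μ(e^φ) = ∫ φe^φ dμ − (∫e^φ dμ)·log ∫e^φ dμ ≤ ∫ (φe^φ − e^φ·log r − e^φ + r) dμ` (equality at `r = ∫ e^φ dμ`; the gap is
`A log(A∕r) − A + r ≥ 0`, `A = ∫ e^φ dμ`). -/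
theorem entropy_exp_le_variational {φ : α → ℝ} (hφm : Measurable φ) {Mφ : ℝ} (hφb : ∀ x, |φ x| ≤ Mφ) {r : ℝ} (hr : 0 < r) :
    ∫ x, φ x * Real.exp (φ x) ∂μ - (∫ x, Real.exp (φ x) ∂μ) * Real.log (∫ x, Real.exp (φ x) ∂μ) ≤
      ∫ x, (φ x * Real.exp (φ x) - Real.exp (φ x) * Real.log r - Real.exp (φ x) + r) ∂μ := by
  have hem : Measurable fun x => Real.exp (φ x) := Real.measurable_exp.comp hφm
  have heb : ∀ x, |Real.exp (φ x)| ≤ Real.exp Mφ := fun x => by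
    rw [abs_of_pos (Real.exp_pos _), Real.exp_le_exp]; exact (le_abs_self _).trans (hφb x)
  have hei : Integrable (fun x => Real.exp (φ x)) μ :=
    (integrable_const _).mono' hem.aestronglyMeasurable (Eventually.of_forall fun x => by rw [Real.norm_eq_abs]; exact heb x)
  have hpe : Integrable (fun x => φ x * Real.exp (φ x)) μ :=
    (integrable_const (Mφ * Real.exp Mφ)).mono' (hφm.mul hem).aestronglyMeasurable (Eventually.of_forall fun x => by
      rw [Real.norm_eq_abs, abs_mul]
      exact mul_le_mul (hφb x) (heb x) (abs_nonneg _) ((abs_nonneg _).trans (hφb x)))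
  set A : ℝ := ∫ x, Real.exp (φ x) ∂μ with hA
  have hApos : 0 < A := integral_exp_pos hei
  have hsplit : ∫ x, (φ x * Real.exp (φ x) - Real.exp (φ x) * Real.log r - Real.exp (φ x) + r) ∂μ =
      (∫ x, φ x * Real.exp (φ x) ∂μ) - A * Real.log r - A + r := by
    have h1 : ∫ x, (φ x * Real.exp (φ x) - Real.exp (φ x) * Real.log r - Real.exp (φ x) + r) ∂μ =
        ∫ x, (φ x * Real.exp (φ x) - Real.exp (φ x) * Real.log r - Real.exp (φ x)) ∂μ + ∫ x, (r : ℝ) ∂μ :=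
      integral_add ((hpe.sub (hei.mul_const _)).sub hei) (integrable_const r)
    have h2 : ∫ x, (φ x * Real.exp (φ x) - Real.exp (φ x) * Real.log r - Real.exp (φ x)) ∂μ =
        ∫ x, (φ x * Real.exp (φ x) - Real.exp (φ x) * Real.log r) ∂μ - ∫ x, Real.exp (φ x) ∂μ :=
      integral_sub (hpe.sub (hei.mul_const _)) hei
    have h3 : ∫ x, (φ x * Real.exp (φ x) - Real.exp (φ x) * Real.log r) ∂μ =
        ∫ x, φ x * Real.exp (φ x) ∂μ - ∫ x, Real.exp (φ x) * Real.log r ∂μ := integral_sub hpe (hei.mul_const _)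
    rw [h1, h2, h3, integral_mul_const]
    simp [hA]
  rw [hsplit]
  have hgap := mul_log_sub_nonneg hApos hr
  rw [Real.log_div hApos.ne' hr.ne'] at hgap
  nlinarith [hgap]

/-- **THE DENSITY OF A BOUNDED TILT** [folklore]: for `a ≤ U ≤ b` measurable and `μ` a probability measure, the density
`ρ = e^U ∕ ∫e^U dμ` of `μ.tilted U` satisfies `e^{a−b} ≤ ρ ≤ e^{b−a}`. -/
theorem density_bounds_tilted {U : α → ℝ} (hUm : Measurable U) {a b : ℝ} (hUa : ∀ x, a ≤ U x) (hUb : ∀ x, U x ≤ b) (x : α) :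
    Real.exp (a - b) ≤ Real.exp (U x) / ∫ y, Real.exp (U y) ∂μ ∧ Real.exp (U x) / ∫ y, Real.exp (U y) ∂μ ≤ Real.exp (b - a) := by
  have hint : Integrable (fun y => Real.exp (U y)) μ :=
    (integrable_const (Real.exp b)).mono' (Real.measurable_exp.comp hUm).aestronglyMeasurable (Eventually.of_forall fun y => by
      rw [Real.norm_eq_abs, abs_of_pos (Real.exp_pos _), Real.exp_le_exp]; exact hUb y)
  have hZlo : Real.exp a ≤ ∫ y, Real.exp (U y) ∂μ := by
    have h := integral_mono (integrable_const (Real.exp a)) hint fun y => Real.exp_le_exp.2 (hUa y)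
    simpa using h
  have hZhi : ∫ y, Real.exp (U y) ∂μ ≤ Real.exp b := by
    have h := integral_mono hint (integrable_const (Real.exp b)) fun y => Real.exp_le_exp.2 (hUb y)
    simpa using h
  have hZpos : 0 < ∫ y, Real.exp (U y) ∂μ := (Real.exp_pos a).trans_le hZlo
  constructor
  · rw [Real.exp_sub, div_le_div_iff₀ (Real.exp_pos b) hZpos]
    exact mul_le_mul (Real.exp_le_exp.2 (hUa x)) hZhi hZpos.le (Real.exp_pos _).le
  · rw [Real.exp_sub, div_le_div_iff₀ hZpos (Real.exp_pos a)]
    calc Real.exp (U x) * Real.exp a ≤ Real.exp b * Real.exp a := mul_le_mul_of_nonneg_right (Real.exp_le_exp.2 (hUb x)) (Real.exp_pos a).le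
      _ ≤ Real.exp b * ∫ y, Real.exp (U y) ∂μ := mul_le_mul_of_nonneg_left hZlo (Real.exp_pos b).le

end HolleyStroock

section Schema

variable {ν : Measure (EuclideanSpace ℝ (Fin n))} [IsProbabilityMeasure ν] {C : ℝ} {U : EuclideanSpace ℝ (Fin n) → ℝ} {a b : ℝ}

/-- **HOLLEY–STROOCK FOR THE EXPONENTIAL SCHEMA** [folklore; cite: HolleyStroock1987 (J. Stat. Phys. 46, 1159), the bounded-perturbation
lemma, exponential form].  If the probability law `ν` on `ℝⁿ` satisfies `HasEntropyExpC1c ν C` (`C ≥ 0`) and `U` is measurable with `a ≤ U ≤ b`,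
then the tilted law `ν.tilted U` satisfies `HasEntropyExpC1c (ν.tilted U) (C·e^{2(b−a)})`.  Proof: the variational bound at `r = ∫e^φ dν` has a
NONNEGATIVE integrand, so `Ent_{ν_U}(e^φ) ≤ e^{b−a}·Ent_ν(e^φ) ≤ e^{b−a}·(C∕2)∫‖Dφ‖²e^φ dν ≤ e^{2(b−a)}·(C∕2)∫‖Dφ‖²e^φ dν_U`. -/
theorem hasEntropyExpC1c_tilted_of_bounded (h : HasEntropyExpC1c ν C) (hC : 0 ≤ C) (hUm : Measurable U) (hUa : ∀ x, a ≤ U x)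
    (hUb : ∀ x, U x ≤ b) : HasEntropyExpC1c (ν.tilted U) (C * Real.exp (2 * (b - a))) := by
  intro φ hφ hφs
  -- densities and the tilted law
  have hintU : Integrable (fun y => Real.exp (U y)) ν :=
    (integrable_const (Real.exp b)).mono' (Real.measurable_exp.comp hUm).aestronglyMeasurable (Eventually.of_forall fun y => by
      rw [Real.norm_eq_abs, abs_of_pos (Real.exp_pos _), Real.exp_le_exp]; exact hUb y)
  haveI : IsProbabilityMeasure (ν.tilted U) := isProbabilityMeasure_tilted hintU
  set ρ : EuclideanSpace ℝ (Fin n) → ℝ := fun x => Real.exp (U x) / ∫ y, Real.exp (U y) ∂ν with hρ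
  have hρb : ∀ x, Real.exp (a - b) ≤ ρ x ∧ ρ x ≤ Real.exp (b - a) := fun x => density_bounds_tilted hUm hUa hUb x
  have hρ0 : ∀ x, 0 ≤ ρ x := fun x => (Real.exp_pos _).le.trans (hρb x).1
  have hρm : Measurable ρ := (Real.measurable_exp.comp hUm).div_const _
  -- the test function's bounds
  obtain ⟨M, hM⟩ := hφ.continuous.bounded_above_of_compact_support hφs
  have hφb : ∀ x, |φ x| ≤ M := fun x => by simpa [Real.norm_eq_abs] using hM x
  have hDc : Continuous (fderiv ℝ φ) := hφ.continuous_fderiv one_ne_zero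
  obtain ⟨L, hL⟩ := hDc.bounded_above_of_compact_support (hφs.fderiv (𝕜 := ℝ))
  have hφm : Measurable φ := hφ.continuous.measurable
  have hem : Measurable fun x => Real.exp (φ x) := Real.measurable_exp.comp hφm
  -- integrals against `ν.tilted U` are integrals against `ρ · ν`
  have htilt : ∀ g : EuclideanSpace ℝ (Fin n) → ℝ, ∫ x, g x ∂(ν.tilted U) = ∫ x, ρ x * g x ∂ν := fun g => by
    rw [integral_tilted]
    refine integral_congr_ae (Eventually.of_forall fun x => ?_)
    simp only [hρ, smul_eq_mul]
  -- Step 1: variational bound under `ν.tilted U` at `r = ∫ e^φ dν`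
  have hei : Integrable (fun x => Real.exp (φ x)) ν :=
    integrable_of_norm_le_const (Real.continuous_exp.comp hφ.continuous).aestronglyMeasurable (Real.exp M) fun x => by
      rw [Real.norm_eq_abs, abs_of_pos (Real.exp_pos _), Real.exp_le_exp]; exact (le_abs_self _).trans (hφb x)
  have hr : 0 < ∫ x, Real.exp (φ x) ∂ν := integral_exp_pos hei
  set r : ℝ := ∫ x, Real.exp (φ x) ∂ν with hr_def
  set hint : EuclideanSpace ℝ (Fin n) → ℝ := fun x => φ x * Real.exp (φ x) - Real.exp (φ x) * Real.log r - Real.exp (φ x) + r with hh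
  have hh0 : ∀ x, 0 ≤ hint x := fun x => by
    have := mul_log_sub_nonneg (Real.exp_pos (φ x)) hr
    rw [Real.log_div (Real.exp_pos _).ne' hr.ne', Real.log_exp] at this
    simp only [hh]
    nlinarith [this, Real.exp_pos (φ x)]
  have hhm : Measurable hint := ((((hφm.mul hem).sub (hem.mul_const _)).sub hem).add_const r)
  have hhb : ∀ x, |hint x| ≤ M * Real.exp M + Real.exp M * |Real.log r| + Real.exp M + r := fun x => by
    have e1 : |φ x * Real.exp (φ x)| ≤ M * Real.exp M := by
      rw [abs_mul, abs_of_pos (Real.exp_pos _)]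
      exact mul_le_mul (hφb x) (Real.exp_le_exp.2 ((le_abs_self _).trans (hφb x))) (Real.exp_pos _).le ((abs_nonneg _).trans (hφb x))
    have e2 : |Real.exp (φ x) * Real.log r| ≤ Real.exp M * |Real.log r| := by
      rw [abs_mul, abs_of_pos (Real.exp_pos _)]
      exact mul_le_mul_of_nonneg_right (Real.exp_le_exp.2 ((le_abs_self _).trans (hφb x))) (abs_nonneg _)
    have e3 : |Real.exp (φ x)| ≤ Real.exp M := by
      rw [abs_of_pos (Real.exp_pos _), Real.exp_le_exp]; exact (le_abs_self _).trans (hφb x)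
    have e4 : |(r : ℝ)| = r := abs_of_pos hr
    simp only [hh]
    calc |φ x * Real.exp (φ x) - Real.exp (φ x) * Real.log r - Real.exp (φ x) + r|
        ≤ |φ x * Real.exp (φ x) - Real.exp (φ x) * Real.log r - Real.exp (φ x)| + |r| := abs_add_le _ _
      _ ≤ (|φ x * Real.exp (φ x) - Real.exp (φ x) * Real.log r| + |Real.exp (φ x)|) + |r| := by
          gcongr; exact abs_sub _ _
      _ ≤ ((|φ x * Real.exp (φ x)| + |Real.exp (φ x) * Real.log r|) + |Real.exp (φ x)|) + |r| := by
          gcongr; exact abs_sub _ _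
      _ ≤ M * Real.exp M + Real.exp M * |Real.log r| + Real.exp M + r := by rw [e4]; linarith
  have hhi : Integrable hint ν := (integrable_const _).mono' hhm.aestronglyMeasurable (Eventually.of_forall fun x => by
    rw [Real.norm_eq_abs]; exact hhb x)
  have step1 : ∫ x, φ x * Real.exp (φ x) ∂(ν.tilted U) - (∫ x, Real.exp (φ x) ∂(ν.tilted U)) * Real.log (∫ x, Real.exp (φ x) ∂(ν.tilted U))
      ≤ ∫ x, hint x ∂(ν.tilted U) := entropy_exp_le_variational hφm hφb hr
  -- Step 2: `∫ h d(ν.tilted U) = ∫ ρ h dν ≤ e^{b−a} ∫ h dν = e^{b−a} Ent_ν(e^φ)`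
  have step2 : ∫ x, hint x ∂(ν.tilted U) ≤ Real.exp (b - a) * ∫ x, hint x ∂ν := by
    rw [htilt, ← integral_const_mul]
    refine integral_mono_of_nonneg (Eventually.of_forall fun x => mul_nonneg (hρ0 x) (hh0 x)) (hhi.const_mul _)
      (Eventually.of_forall fun x => mul_le_mul_of_nonneg_right (hρb x).2 (hh0 x))
  have hEntν : ∫ x, hint x ∂ν = ∫ x, φ x * Real.exp (φ x) ∂ν - r * Real.log r := by
    have hpe : Integrable (fun x => φ x * Real.exp (φ x)) ν :=
      (integrable_const (M * Real.exp M)).mono' (hφm.mul hem).aestronglyMeasurable (Eventually.of_forall fun x => by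
        rw [Real.norm_eq_abs, abs_mul, abs_of_pos (Real.exp_pos _)]
        exact mul_le_mul (hφb x) (Real.exp_le_exp.2 ((le_abs_self _).trans (hφb x))) (Real.exp_pos _).le ((abs_nonneg _).trans (hφb x)))
    have h1 : ∫ x, hint x ∂ν = ∫ x, (φ x * Real.exp (φ x) - Real.exp (φ x) * Real.log r - Real.exp (φ x)) ∂ν + ∫ x, (r : ℝ) ∂ν :=
      integral_add ((hpe.sub (hei.mul_const _)).sub hei) (integrable_const r)
    have h2 : ∫ x, (φ x * Real.exp (φ x) - Real.exp (φ x) * Real.log r - Real.exp (φ x)) ∂ν =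
        ∫ x, (φ x * Real.exp (φ x) - Real.exp (φ x) * Real.log r) ∂ν - ∫ x, Real.exp (φ x) ∂ν := integral_sub (hpe.sub (hei.mul_const _)) hei
    have h3 : ∫ x, (φ x * Real.exp (φ x) - Real.exp (φ x) * Real.log r) ∂ν =
        ∫ x, φ x * Real.exp (φ x) ∂ν - ∫ x, Real.exp (φ x) * Real.log r ∂ν := integral_sub hpe (hei.mul_const _)
    rw [h1, h2, h3, integral_mul_const]
    simp [hr_def]
  have step3 : ∫ x, hint x ∂ν ≤ C / 2 * ∫ x, ‖fderiv ℝ φ x‖ ^ 2 * Real.exp (φ x) ∂ν := by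
    rw [hEntν]; exact h φ hφ hφs
  -- Step 3: `∫ ‖Dφ‖² e^φ dν ≤ e^{b−a} ∫ ‖Dφ‖² e^φ d(ν.tilted U)`
  have hFm : Measurable fun x => ‖fderiv ℝ φ x‖ ^ 2 * Real.exp (φ x) := (hDc.measurable.norm.pow_const 2).mul hem
  have hF0 : ∀ x, 0 ≤ ‖fderiv ℝ φ x‖ ^ 2 * Real.exp (φ x) := fun x => by positivity
  have hFb' : ∀ x, ‖fderiv ℝ φ x‖ ^ 2 * Real.exp (φ x) ≤ L ^ 2 * Real.exp M := fun x =>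
    mul_le_mul (pow_le_pow_left₀ (norm_nonneg _) (hL x) 2) (Real.exp_le_exp.2 ((le_abs_self _).trans (hφb x))) (Real.exp_pos _).le
      (sq_nonneg _)
  have hρFi : Integrable (fun x => ρ x * (‖fderiv ℝ φ x‖ ^ 2 * Real.exp (φ x))) ν :=
    (integrable_const (Real.exp (b - a) * (L ^ 2 * Real.exp M))).mono' (hρm.mul hFm).aestronglyMeasurable
      (Eventually.of_forall fun x => by
        rw [Real.norm_eq_abs, abs_mul, abs_of_nonneg (hρ0 x), abs_of_nonneg (hF0 x)]
        exact mul_le_mul (hρb x).2 (hFb' x) (hF0 x) (Real.exp_pos _).le)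
  have step4 : ∫ x, ‖fderiv ℝ φ x‖ ^ 2 * Real.exp (φ x) ∂ν ≤ Real.exp (b - a) * ∫ x, ‖fderiv ℝ φ x‖ ^ 2 * Real.exp (φ x) ∂(ν.tilted U) := by
    rw [htilt, ← integral_const_mul]
    refine integral_mono_of_nonneg (Eventually.of_forall hF0) (hρFi.const_mul _) (Eventually.of_forall fun x => ?_)
    -- `F ≤ e^{b−a} ρ F` since `e^{a−b} ≤ ρ`
    have h1 : (1 : ℝ) ≤ Real.exp (b - a) * ρ x := by
      have := mul_le_mul_of_nonneg_left (hρb x).1 (Real.exp_pos (b - a)).le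
      rwa [← Real.exp_add, show b - a + (a - b) = 0 by ring, Real.exp_zero] at this
    have := mul_le_mul_of_nonneg_right h1 (hF0 x)
    rw [one_mul, mul_assoc] at this
    exact this
  -- assemble
  have hexp0 : 0 ≤ Real.exp (b - a) := (Real.exp_pos _).le
  calc ∫ x, φ x * Real.exp (φ x) ∂(ν.tilted U) - (∫ x, Real.exp (φ x) ∂(ν.tilted U)) * Real.log (∫ x, Real.exp (φ x) ∂(ν.tilted U))
      ≤ Real.exp (b - a) * ∫ x, hint x ∂ν := step1.trans step2
    _ ≤ Real.exp (b - a) * (C / 2 * ∫ x, ‖fderiv ℝ φ x‖ ^ 2 * Real.exp (φ x) ∂ν) := mul_le_mul_of_nonneg_left step3 hexp0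
    _ ≤ Real.exp (b - a) * (C / 2 * (Real.exp (b - a) * ∫ x, ‖fderiv ℝ φ x‖ ^ 2 * Real.exp (φ x) ∂(ν.tilted U))) :=
        mul_le_mul_of_nonneg_left (mul_le_mul_of_nonneg_left step4 (by positivity)) hexp0
    _ = C * Real.exp (2 * (b - a)) / 2 * ∫ x, ‖fderiv ℝ φ x‖ ^ 2 * Real.exp (φ x) ∂(ν.tilted U) := by
        rw [show (2 : ℝ) * (b - a) = (b - a) + (b - a) by ring, Real.exp_add]; ring

end Schema

/-! ## §2 The Hessian-free tilt of the engine -/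
section Tilt

variable {ν : Measure (EuclideanSpace ℝ (Fin n))} [IsProbabilityMeasure ν] {C : ℝ} {U F : EuclideanSpace ℝ (Fin n) → ℝ} {a b BF L : ℝ}

/-- **HERBST UNDER A BOUNDED SOURCE TILT, NO HESSIAN LETTER** [folklore ∘ files A∕D; cite: HolleyStroock1987; BakryGentilLedoux2014, Prop. 5.4.1].
Schema `HasEntropyExpC1c ν C` (`C > 0`), source `U` measurable with `a ≤ U ≤ b`, observable `F ∈ C¹` bounded with `‖DF‖ ≤ L` (`L > 0`) ⇒
under `ν_U = ν.tilted U`: `HasSubgaussianMGF (F − ∫F dν_U) ⟨C·e^{2(b−a)}·L²⟩ ν_U`. -/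
theorem hasSubgaussianMGF_tilted_of_hasEntropyExpC1c (h : HasEntropyExpC1c ν C) (hC : 0 < C) (hUm : Measurable U) (hUa : ∀ x, a ≤ U x)
    (hUb : ∀ x, U x ≤ b) (hF : ContDiff ℝ 1 F) (hFb : ∀ x, |F x| ≤ BF) (hFD : ∀ x, ‖fderiv ℝ F x‖ ≤ L) (hL : 0 < L) :
    HasSubgaussianMGF (fun x => F x - ∫ z, F z ∂(ν.tilted U)) ⟨C * Real.exp (2 * (b - a)) * L ^ 2, by positivity⟩ (ν.tilted U) := by
  have hintU : Integrable (fun y => Real.exp (U y)) ν :=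
    (integrable_const (Real.exp b)).mono' (Real.measurable_exp.comp hUm).aestronglyMeasurable (Eventually.of_forall fun y => by
      rw [Real.norm_eq_abs, abs_of_pos (Real.exp_pos _), Real.exp_le_exp]; exact hUb y)
  haveI : IsProbabilityMeasure (ν.tilted U) := isProbabilityMeasure_tilted hintU
  exact hasSubgaussianMGF_of_hasEntropyExpC1c (hasEntropyExpC1c_tilted_of_bounded h hC.le hUm hUa hUb) (by positivity) hF hFb hFD hL

/-- **THE UNIFORMLY LOG-CONCAVE FIBRE TILTED BY A BOUNDED SOURCE, NO LETTER ON THE SOURCE** [folklore ∘ the cited, proved facts].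
`ν = e^{−V}dx∕Z` with `V` continuous `λ`-uniformly convex, source `s·G` with `G` measurable, `|G| ≤ B₀`, `|s| ≤ l₀`; observable `F ∈ C¹` bounded
with `‖DF‖ ≤ L` (`L > 0`).  Then under `ν.tilted (s·G)`: `HasSubgaussianMGF (F − ∫F) ⟨e^{4 l₀ B₀}·L²∕λ⟩` — compare file B's `λ − l₀M` route,
which needs the two-sided first-order letter `M` on `G`; here `G` need not even be continuous. -/
theorem hasSubgaussianMGF_sourceTilt_of_uniformlyConvex {V G : EuclideanSpace ℝ (Fin n) → ℝ} {lam B₀ l₀ s : ℝ} (hlam : 0 < lam)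
    (hVc : Continuous V) (hV : ∀ x y : EuclideanSpace ℝ (Fin n), V x + ⟪gradient V x, y - x⟫ + lam / 2 * ‖y - x‖ ^ 2 ≤ V y)
    (hZ : Integrable fun x => Real.exp (-V x)) (hGm : Measurable G) (hGb : ∀ x, |G x| ≤ B₀) (hs : |s| ≤ l₀) (hF : ContDiff ℝ 1 F)
    (hFb : ∀ x, |F x| ≤ BF) (hFD : ∀ x, ‖fderiv ℝ F x‖ ≤ L) (hL : 0 < L) :
    HasSubgaussianMGF (fun x => F x - ∫ z, F z ∂((volume.tilted fun x => -V x).tilted fun x => s * G x))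
      ⟨Real.exp (4 * l₀ * B₀) * L ^ 2 / lam, by positivity⟩ ((volume.tilted fun x => -V x).tilted fun x => s * G x) := by
  haveI : IsProbabilityMeasure ((volume : Measure (EuclideanSpace ℝ (Fin n))).tilted fun x => -V x) := isProbabilityMeasure_tilted_neg hZ
  have hschema : HasEntropyExpC1c ((volume : Measure (EuclideanSpace ℝ (Fin n))).tilted fun x => -V x) (1 / lam) :=
    fun φ hφ hφs => entropyC1c_of_uniformlyConvex hlam hVc hV hZ φ hφ hφs
  have hsB : ∀ x, |s * G x| ≤ l₀ * B₀ := fun x => by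
    rw [abs_mul]; exact mul_le_mul hs (hGb x) (abs_nonneg _) ((abs_nonneg s).trans hs)
  have hUa : ∀ x, -(l₀ * B₀) ≤ s * G x := fun x => (abs_le.1 (hsB x)).1
  have hUb : ∀ x, s * G x ≤ l₀ * B₀ := fun x => (abs_le.1 (hsB x)).2
  have h := hasSubgaussianMGF_tilted_of_hasEntropyExpC1c hschema (one_div_pos.2 hlam) (hGm.const_mul s) hUa hUb hF hFb hFD hL
  have e : (⟨1 / lam * Real.exp (2 * (l₀ * B₀ - -(l₀ * B₀))) * L ^ 2, by positivity⟩ : ℝ≥0) =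
      ⟨Real.exp (4 * l₀ * B₀) * L ^ 2 / lam, by positivity⟩ := by
    ext
    push_cast
    rw [show (2 : ℝ) * (l₀ * B₀ - -(l₀ * B₀)) = 4 * l₀ * B₀ by ring]
    field_simp
  rwa [e] at h

end Tilt

/-! ## §3 The Hessian-free tilted step: fibres with the schema uniformly in the background, tilted by a bounded source -/
section TiltedStep

variable {Bk : Type*} [MeasurableSpace Bk] {ν : Measure Bk} [IsProbabilityMeasure ν] {κ η : Kernel Bk (EuclideanSpace ℝ (Fin n))}
  [IsMarkovKernel κ] [IsMarkovKernel η] {G F : Bk × EuclideanSpace ℝ (Fin n) → ℝ} {C l₀ s B₀ BF LF : ℝ}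

/-- **THE TILTED STEP AT SCHEMA LEVEL (boxes included)** [folklore ∘ files C∕D∕E + §1; cite: HolleyStroock1987; BakryGentilLedoux2014, Prop. 5.4.1].
Background law `ν`; Markov fibre kernel `κ` whose EVERY fibre satisfies RR-2's schema `HasEntropyExpC1c (κ b) C` (`C > 0`; e.g. box fibres by
`bobkovLedoux2000_prop31_convexDomain_exp`); tilt source `G` measurable with `|G| ≤ B₀`, `|s| ≤ l₀`; `η` any Markov version of the tilted fibres;
observable `F` measurable, `|F| ≤ B_F`, `F (b,·) ∈ C¹` with fibre gradient `≤ L_F` (`L_F > 0`); the tilted-fibre average of `F` sub-Gaussian `c` under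
the background law tilted by the fibre cumulant.  Then under `μ_s = (ν ⊗ₘ κ).tilted (s·G)`:
`HasSubgaussianMGF (F − ∫F dμ_s) (c + C·e^{4l₀B₀}·L_F²) μ_s` — NO Hessian letter on `G`, NO whole-space convexity: the realistic small-field step. -/
theorem hasSubgaussianMGF_tilted_compProd_of_schema {c : ℝ≥0} (hκC : ∀ b, HasEntropyExpC1c (κ b) C) (hC : 0 < C) (hGm : Measurable G)
    (hGb : ∀ p, |G p| ≤ B₀) (hs : |s| ≤ l₀) (hη : ∀ b, η b = (κ b).tilted fun x => s * G (b, x)) (hFm : Measurable F)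
    (hF : ∀ b, ContDiff ℝ 1 fun x => F (b, x)) (hFb : ∀ p, |F p| ≤ BF) (hFD : ∀ b x, ‖fderiv ℝ (fun z => F (b, z)) x‖ ≤ LF) (hLF : 0 < LF)
    (hbase : HasSubgaussianMGF
      (fun b => (∫ x, F (b, x) ∂(η b)) - ∫ b', (∫ x, F (b', x) ∂(η b')) ∂(ν.tilted fun b => Real.log (∫ x, Real.exp (s * G (b, x)) ∂(κ b))))
      c (ν.tilted fun b => Real.log (∫ x, Real.exp (s * G (b, x)) ∂(κ b)))) :
    HasSubgaussianMGF (fun p => F p - ∫ q, F q ∂((ν ⊗ₘ κ).tilted fun p => s * G p))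
      (c + ⟨C * Real.exp (4 * l₀ * B₀) * LF ^ 2, by positivity⟩) ((ν ⊗ₘ κ).tilted fun p => s * G p) := by
  have hfb : ∀ p : Bk × EuclideanSpace ℝ (Fin n), |s * G p| ≤ |s| * B₀ := fun p => by
    rw [abs_mul]; exact mul_le_mul_of_nonneg_left (hGb p) (abs_nonneg _)
  rw [YMDAG.N14.ConvexFibreTilt.compProd_tilted (ν := ν) (κ := κ) (η := η) (hGm.const_mul s) hfb hη]
  haveI := YMDAG.N14.ConvexFibreTilt.isProbabilityMeasure_tilted_fibreCumulant (ν := ν) (κ := κ) hGm hGb s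
  refine YMDAG.N14.ConvexFibreStep.hasSubgaussianMGF_compProd_of_fibre hFm hFb hbase fun b t => ?_
  -- each tilted fibre: Holley–Stroock with `U = s·G(b,·) ∈ [−l₀B₀, l₀B₀]`, then Herbst
  have hsB : ∀ x, |s * G (b, x)| ≤ l₀ * B₀ := fun x => by
    rw [abs_mul]; exact mul_le_mul hs (hGb (b, x)) (abs_nonneg _) ((abs_nonneg s).trans hs)
  have h := (hasSubgaussianMGF_tilted_of_hasEntropyExpC1c (ν := κ b) (hκC b) hC ((hGm.comp measurable_prodMk_left).const_mul s)
    (fun x => (abs_le.1 (hsB x)).1) (fun x => (abs_le.1 (hsB x)).2) (hF b) (fun x => hFb (b, x)) (hFD b) hLF).mgf_le t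
  rw [hη b]
  refine h.trans (le_of_eq ?_)
  congr 1
  rw [show (2 : ℝ) * (l₀ * B₀ - -(l₀ * B₀)) = 4 * l₀ * B₀ by ring]

end TiltedStep

/-! ## §4 The box engine in Mathlib's `StrongConvexOn` currency (the NE7b convexity road's letter) -/
section StrongConvex

variable {Ω : Set (EuclideanSpace ℝ (Fin n))} {V G : EuclideanSpace ℝ (Fin n) → ℝ} {c B L : ℝ}

/-- **THE BOX FIBRE FROM `StrongConvexOn`** [folklore ∘ file D ∘ NE7b's `StrongConvexSubgradientField.exists_firstOrderOn_field_of_strongConvexOn`;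
cite: BobkovLedoux2000, Prop. 3.1].  `Ω` open convex with `volume Ω ≠ 0`, `V` continuous on `Ω` with Mathlib's `StrongConvexOn Ω c V` (`c > 0`;
NO differentiability — the first-order field is a strong subgradient selection), `e^{−V}` integrable on `Ω`, `G ∈ C¹` bounded with `‖DG‖ ≤ L`
(`L > 0`) ⇒ under the box law `(volume.restrict Ω).tilted (−V)`: `HasSubgaussianMGF (G − ∫G) ⟨L²∕c⟩`.  This is the currency of the NE7b
convexity road's torus actions (`SupTorusActionConvexEuclid.torus_strongConvexOn_action`), which therefore feed the engine by name. -/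
theorem hasSubgaussianMGF_box_of_strongConvexOn (hΩo : IsOpen Ω) (hΩc : Convex ℝ Ω) (hΩ0 : volume Ω ≠ 0) (hc : 0 < c)
    (hV : StrongConvexOn Ω c V) (hVc : ContinuousOn V Ω) (hZ : IntegrableOn (fun x => Real.exp (-V x)) Ω) (hG : ContDiff ℝ 1 G)
    (hGb : ∀ x, |G x| ≤ B) (hGD : ∀ x, ‖fderiv ℝ G x‖ ≤ L) (hL : 0 < L) :
    HasSubgaussianMGF (fun x => G x - ∫ z, G z ∂((volume.restrict Ω).tilted fun x => -V x)) ⟨L ^ 2 / c, by positivity⟩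
      ((volume.restrict Ω).tilted fun x => -V x) := by
  obtain ⟨W, hW⟩ :=
    Summit.QuantumFields.BalabanUV.T4Continuum.NE7b.StrongConvexSubgradientField.exists_firstOrderOn_field_of_strongConvexOn hV hΩo
  exact YMDAG.N14.ConvexFibreBox.hasSubgaussianMGF_box_of_uniformlyConvexOn (W := W) hΩo hΩc hΩ0 hc hVc hW hZ hG hGb hGD hL

/-- **THE BORN CUMULANT OF A `StrongConvexOn` BOX FIBRE** [folklore]: `cgf G ν_Ω t − t·∫G dν_Ω ≤ (L²∕c)·t²∕2` for every real `t`. -/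
theorem bornCumulant_box_le_of_strongConvexOn (hΩo : IsOpen Ω) (hΩc : Convex ℝ Ω) (hΩ0 : volume Ω ≠ 0) (hc : 0 < c)
    (hV : StrongConvexOn Ω c V) (hVc : ContinuousOn V Ω) (hZ : IntegrableOn (fun x => Real.exp (-V x)) Ω) (hG : ContDiff ℝ 1 G)
    (hGb : ∀ x, |G x| ≤ B) (hGD : ∀ x, ‖fderiv ℝ G x‖ ≤ L) (hL : 0 < L) (t : ℝ) :
    cgf G ((volume.restrict Ω).tilted fun x => -V x) t - t * ∫ z, G z ∂((volume.restrict Ω).tilted fun x => -V x) ≤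
      L ^ 2 / c * t ^ 2 / 2 := by
  obtain ⟨W, hW⟩ :=
    Summit.QuantumFields.BalabanUV.T4Continuum.NE7b.StrongConvexSubgradientField.exists_firstOrderOn_field_of_strongConvexOn hV hΩo
  exact YMDAG.N14.ConvexFibreBox.bornCumulant_box_le (W := W) hΩo hΩc hΩ0 hc hVc hW hZ hG hGb hGD hL t

end StrongConvex

end YMDAG.N14.ConvexFibrePerturb

end
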